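import Mathlib.Probability.Distributions.Gaussian.Multivariate
import Mathlib.Probability.Moments.Basic
import Literature.MathematicalPhysics.QuantumFieldTheory.Balaban1983to89.B1Eq324BenfattoLemma
import HarnessLib

/-!
# `Balaban1983to89.B1Eq324BenfattoAppendixC` — G. Benfatto, M. Cassandro, G. Gallavotti, F. Nicolò, E. Olivieri, E. Presutti,
# E. Scacciatelli, *Some probabilistic techniques in field theory*, Commun. Math. Phys. **59** (1978) 143–166 [BenfattoEtAl1978],
# APPENDIX C p. 165: LEMMA 1 (C.9) AS PRINTED, PROVED (the joint large-field bound for positively correlated Gaussians), and the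
# diagonal part of (C.6) (conditioning lowers the variance) for the tree's conditioned field

statement-level skeleton of published theorems with citation tags; proofs where landed; nothing here is a claim about the
Yang–Mills mass gap

WHY THIS MODULE (cell `pub-ymgap`, seat `dag-n08-b` = node N08 [Balaban1985UV3] «first missing estimate» lane; desk answer
ME #23 of the `lit-balaban` service desk, 2026-08-27).  [Balaban1985UV3] (24) p. 262 / (58) p. 270 ← [Balaban1982Higgs1] (3.24)
p. 616 ← [BenfattoEtAl1978] Lemma p. 152 (`B1Eq324BenfattoLemma.BasicLemmaPrinted`, a named fact); §5's proof of that Lemma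
(pp. 153–159) and Appendix D use three Gaussian inputs: the Lemma of Appendix A (PROVED: `B1Eq324BenfattoAppendixA`), and
the two lemmas of Appendix C p. 165 («The replacement of the χ′_s by 1 is a trivial consequence of point 2) and Lemma 1 of
Appendix C», App. D p. 165).  This file proves LEMMA 1 as printed and the variance half of «point 2)».

THE PRINTED TEXT (p. 165, read from the page images `HOME/inprint/lit-balaban-lead/benfatto1978-cmp59/bcg_p165-*.png` by the
lit-balaban desk, ME #23; verbatim): *"The following lemmas hold. **Lemma 1.** Given n gaussian variables {z_i}_{i=1}^{n} with
covariance C_ij > 0, i, j = 1,…,n and given b₁,…,b_n > 0:* `∫ Π_{i=1}^{n} χ(|z_i| > b_i) dP ≦ exp[−Σ_{i=1}^{n} (b_i²/(2‖C‖) − log 2)]`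
*(C.9) where* `‖C‖ = sup_i Σ_{j=1}^{n} C_ij`. *Proof. If γ > 0:* `e^{γΣ_i b_i²} ∫[Π_{i=1}^{k} χ(z_i > b_i)][Π_{i=k+1}^{n} χ(z_i < −b_i)]dP
≦ ∫ Π_{i≤k}χ(z_i > b_i) Π_{i>k}χ(z_i < −b_i) exp(Σ_{i≤k} γb_iz_i − Σ_{i>k} γb_iz_i) dP ≦ ∫ exp(Σ_{i≤k} γb_iz_i − Σ_{i>k} γb_iz_i) dP
≦ exp[½Σ_{i,j} γ²b_ib_jC_ij]`. *Hence* `∫Π_{i≤k}χ(z_i > b_i)Π_{i>k}χ(z_i < −b_i)dP ≦ exp[−γ(1 − (γ/2)‖C‖)Σ_i b_i²]` *and the lemma follows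
by choosing γ = 1/‖C‖."*  Point 2) p. 164 (verbatim): *"Let Γ be a region paved by Q₀ and let P̂₀(dz|z_Γ) denotes the above
probability measure conditioned to fixed values of the z_Δ's, Δ ∈ Γ. Then the conditioned variables (z_Δ)_{Δ∉Γ} are a non
centered gaussian field with covariance C^Γ_{ΔΔ′} such that 0 ≦ C^Γ_{ΔΔ′} ≦ C_{ΔΔ′} (C.6) and center u_Δ = … (C.7)"*.

DICTIONARY (print ↦ Lean).  «n gaussian variables with covariance C» ↦ Mathlib's centred multivariate Gaussian
`multivariateGaussian 0 C` on `EuclideanSpace ℝ (Fin n)` (coordinates `x i`; the vocabulary of the tree's Šidák files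
`KhatriSidak`, `GaussianSmallField`), `C.PosSemidef`; «C_ij > 0» ↦ `0 ≤ C i j` (the proof uses only non-negativity, so the theorem
is stated under the weaker hypothesis; positive semidefiniteness is «gaussian variables»); «Π_i χ(|z_i| > b_i)» ↦ the event
`{x | ∀ i, b i < |x i|}`; «‖C‖ = sup_i Σ_j C_ij» ↦ `⨆ i, ∑ j, C i j` (inlined; on `Fin n` the supremum is attained, and at `n = 0`
both sides of (C.9) equal `1`).  Point 2)'s conditioned field and its covariance `C^Γ` are the tree's `B1Eq324BenfattoLemma.condField`
/ `condCov` (Gaussian regression = Schur complement).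

WHAT IS PROVED (no definition, no named fact, no `sorry`; axioms standard).
* §1 **`appC_lemma1` = (C.9) AS PRINTED**, along print's route: for each of the `2ⁿ` sign patterns `s ⊆ {1,…,n}` the event
  `{εᵢxᵢ > bᵢ ∀i}` (`εᵢ = ±1`) lies in `{⟪w_s, x⟫ ≥ Σbᵢ²}` with `w_s = (εᵢbᵢ)ᵢ`; Chernoff (`measure_ge_le_exp_mul_mgf`) with the
  Gaussian moment generating function of the linear functional `⟪w_s, ·⟫` (law `gaussianReal 0 (w_sᵀCw_s)` by
  `IsGaussian.map_eq_gaussianReal` + `covarianceBilin_multivariateGaussian`) and `w_sᵀCw_s ≤ Σ_{ij} bᵢbⱼC_ij ≤ ‖C‖Σbᵢ²`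
  (non-negativity + symmetry of `C`) gives `e^{−γ(1−γ‖C‖/2)Σbᵢ²}` per pattern; `γ = 1/‖C‖` and the union over patterns give (C.9)
  (private steps `quadForm_sign_le`, `measureReal_signEvent_le`; the degenerate `‖C‖ = 0` makes the printed right side `2ⁿ ≥ 1`).
* §2 **`condCov_self_le` = (C.6), diagonal part**, for every positive semidefinite kernel `G` on `Q₀`: `condCov G Γ x x ≤ G x x`
  (the subtracted Schur term is the quadratic form of `(G_ΓΓ)⁻¹ ⪰ 0`, `Matrix.PosSemidef.inv`) — the variance input of Lemma 2.

NOT HERE (census, for the lineage): LEMMA 2 p. 165 (the conditioned small-field volume `≥ 1 − 2|□|e^{−b²/4}` under the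
boundary-ratio condition) — it needs (C.6) ENTRYWISE (`0 ≤ C^Γ ≤ C`, the random-walk representation (C.3)), the centre formula
(C.7) (the Markov property of (C.1)) with the bound (C.8), and it carries a print-internal `α² ↔ 2d` transposition between (C.8)
and its side condition (desk ME #23 note (c)); also (C.2)–(C.5) (decay, walk expansion and total mass `1/(α²β)` of the free
covariance).  NOT summit progress; count-neutral for N08; nothing of [Balaban1985UV3] is asserted.
-/

noncomputable section

open MeasureTheory ProbabilityTheory Finset WithLp
open scoped BigOperators NNReal ENNReal Matrix InnerProductSpace

namespace Literature.MathematicalPhysics.QuantumFieldTheory.Balaban1983to89.B1Eq324BenfattoAppendixC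

/-! ## §1  Lemma 1 of Appendix C, (C.9) -/

section Lemma1

variable {n : ℕ}

/-- `⟪(εᵢbᵢ)ᵢ, x⟫ = Σᵢ εᵢ bᵢ xᵢ` on `EuclideanSpace ℝ (Fin n)`. [folklore] -/
private theorem inner_toLp_mul (ε b : Fin n → ℝ) (x : EuclideanSpace ℝ (Fin n)) :
    ⟪toLp 2 (fun i => ε i * b i), x⟫_ℝ = ∑ i, ε i * b i * x i := by
  rw [PiLp.inner_apply]
  refine Finset.sum_congr rfl fun i _ => ?_
  rw [show toLp 2 (fun i => ε i * b i) i = ε i * b i from rfl]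
  simp only [RCLike.inner_apply, conj_trivial]
  ring

/-- **The quadratic-form step of print's proof**: `Σ_{ij} (εᵢbᵢ)(εⱼbⱼ)C_ij ≤ Σ_{ij} bᵢbⱼC_ij ≤ ‖C‖ Σᵢ bᵢ²` for `C_ij ≥ 0` symmetric,
`bᵢ ≥ 0`, `Σⱼ C_ij ≤ N` (`2bᵢbⱼ ≤ bᵢ² + bⱼ²`). [cite: BenfattoEtAl1978, Appendix C Lemma 1 proof p.165] -/
private theorem quadForm_sign_le {C : Matrix (Fin n) (Fin n) ℝ} (hsymm : ∀ i j, C i j = C j i)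
    (hpos : ∀ i j, 0 ≤ C i j) {b : Fin n → ℝ} (hb : ∀ i, 0 ≤ b i) {N : ℝ} (hrow : ∀ i, ∑ j, C i j ≤ N)
    {ε : Fin n → ℝ} (hε : ∀ i, |ε i| = 1) :
    ∑ i, ∑ j, (ε i * b i) * C i j * (ε j * b j) ≤ N * ∑ i, b i ^ 2 := by
  -- drop the signs
  have h1 : ∑ i, ∑ j, (ε i * b i) * C i j * (ε j * b j) ≤ ∑ i, ∑ j, b i * C i j * b j := by
    refine Finset.sum_le_sum fun i _ => Finset.sum_le_sum fun j _ => ?_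
    have habs : |(ε i * b i) * C i j * (ε j * b j)| = b i * C i j * b j := by
      rw [abs_mul, abs_mul, abs_mul, abs_mul, hε i, hε j, abs_of_nonneg (hb i), abs_of_nonneg (hb j),
        abs_of_nonneg (hpos i j)]
      ring
    exact (le_abs_self _).trans habs.le
  -- AM–GM and symmetry
  have h2 : ∑ i, ∑ j, b i * C i j * b j ≤ ∑ i, ∑ j, C i j * (b i ^ 2 + b j ^ 2) / 2 := by
    refine Finset.sum_le_sum fun i _ => Finset.sum_le_sum fun j _ => ?_
    nlinarith [sq_nonneg (b i - b j), hpos i j]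
  have h3 : ∑ i, ∑ j, C i j * (b i ^ 2 + b j ^ 2) / 2 =
      (∑ i, b i ^ 2 * ∑ j, C i j) / 2 + (∑ j, b j ^ 2 * ∑ i, C i j) / 2 := by
    have hA : ∑ i, ∑ j, C i j * (b i ^ 2 + b j ^ 2) / 2 =
        ∑ i, ∑ j, (C i j * b i ^ 2 / 2 + C i j * b j ^ 2 / 2) := by
      refine Finset.sum_congr rfl fun i _ => Finset.sum_congr rfl fun j _ => ?_
      ring
    rw [hA]
    simp only [Finset.sum_add_distrib]
    congr 1
    · rw [Finset.sum_div]
      refine Finset.sum_congr rfl fun i _ => ?_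
      rw [Finset.mul_sum, Finset.sum_div]
      refine Finset.sum_congr rfl fun j _ => ?_
      ring
    · rw [Finset.sum_comm, Finset.sum_div]
      refine Finset.sum_congr rfl fun j _ => ?_
      rw [Finset.mul_sum, Finset.sum_div]
      refine Finset.sum_congr rfl fun i _ => ?_
      ring
  have h4 : ∑ i, b i ^ 2 * ∑ j, C i j ≤ N * ∑ i, b i ^ 2 := by
    rw [Finset.mul_sum]
    refine Finset.sum_le_sum fun i _ => ?_
    rw [mul_comm N]
    exact mul_le_mul_of_nonneg_left (hrow i) (sq_nonneg _)
  have h5 : ∑ j, b j ^ 2 * ∑ i, C i j ≤ N * ∑ i, b i ^ 2 := by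
    have : ∑ j, b j ^ 2 * ∑ i, C i j = ∑ j, b j ^ 2 * ∑ i, C j i := by
      refine Finset.sum_congr rfl fun j _ => ?_
      congr 1
      exact Finset.sum_congr rfl fun i _ => hsymm i j
    rw [this]
    exact h4
  linarith

variable (C : Matrix (Fin n) (Fin n) ℝ)

/-- **One sign pattern (the «Hence» display of print's proof at `γ = 1/‖C‖`)**: for `C ⪰ 0` with `C_ij ≥ 0`, `bᵢ > 0`, row sums
`≤ N` with `N > 0`: `P(εᵢxᵢ > bᵢ ∀ i) ≤ exp(−Σbᵢ²/(2N))`. [cite: BenfattoEtAl1978, Appendix C Lemma 1 proof p.165] -/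
private theorem measureReal_signEvent_le (hC : C.PosSemidef) (hpos : ∀ i j, 0 ≤ C i j) {b : Fin n → ℝ}
    (hb : ∀ i, 0 < b i) {N : ℝ} (hN : 0 < N) (hrow : ∀ i, ∑ j, C i j ≤ N) {ε : Fin n → ℝ} (hε : ∀ i, |ε i| = 1) :
    (multivariateGaussian 0 C).real {x | ∀ i, b i < ε i * x i} ≤
      Real.exp (-((∑ i, b i ^ 2) / (2 * N))) := by
  set P := multivariateGaussian 0 C with hP
  set w : EuclideanSpace ℝ (Fin n) := toLp 2 (fun i => ε i * b i) with hw
  set L : StrongDual ℝ (EuclideanSpace ℝ (Fin n)) := innerSL ℝ w with hL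
  have hLapply : ∀ x, L x = ⟪w, x⟫_ℝ := fun x => rfl
  -- the law of the tilt functional
  have hmap := IsGaussian.map_eq_gaussianReal (μ := P) L
  have hmean : P[L] = 0 := by
    rw [ContinuousLinearMap.integral_comp_id_comm, hP, integral_id_multivariateGaussian, map_zero]
    exact IsGaussian.integrable_id
  have hvar : Var[L; P] = w ⬝ᵥ C *ᵥ w := by
    rw [← covarianceBilin_multivariateGaussian hC w w, covarianceBilin_self IsGaussian.memLp_two_id]
    rfl
  rw [hmean] at hmap
  -- the quadratic form `w ⬝ᵥ C w ≤ N Σ b²`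
  have hquad : w ⬝ᵥ C *ᵥ w ≤ N * ∑ i, b i ^ 2 := by
    have hexp : w ⬝ᵥ C *ᵥ w = ∑ i, ∑ j, (ε i * b i) * C i j * (ε j * b j) := by
      simp only [dotProduct, Matrix.mulVec, Finset.mul_sum, hw]
      refine Finset.sum_congr rfl fun i _ => Finset.sum_congr rfl fun j _ => ?_
      ring
    rw [hexp]
    exact quadForm_sign_le (fun i j => by simpa using (hC.isHermitian.apply i j).symm) hpos
      (fun i => (hb i).le) hrow hε
  have hvar_le : ((Var[L; P]).toNNReal : ℝ) ≤ N * ∑ i, b i ^ 2 := by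
    rw [Real.coe_toNNReal', hvar]
    exact max_le hquad (by positivity)
  -- Chernoff
  set γ : ℝ := 1 / N with hγ
  have hγ0 : 0 ≤ γ := by positivity
  have hint : Integrable (fun x => Real.exp (γ * L x)) P := by
    have h1 : Integrable (fun y : ℝ => Real.exp (γ * y)) (P.map L) := by
      rw [hmap]
      exact integrable_exp_mul_gaussianReal γ
    exact (integrable_map_measure (by fun_prop) L.continuous.measurable.aemeasurable).1 h1
  have hcher := measure_ge_le_exp_mul_mgf (μ := P) (X := fun x => L x) (∑ i, b i ^ 2) hγ0 hint
  have hmgf : mgf (fun x => L x) P γ = Real.exp (0 * γ + ((Var[L; P]).toNNReal : ℝ) * γ ^ 2 / 2) :=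
    mgf_gaussianReal hmap γ
  -- the event inclusion `{εx > b} ⊆ {Σb² ≤ L x}`
  have hsub : {x : EuclideanSpace ℝ (Fin n) | ∀ i, b i < ε i * x i} ⊆ {x | ∑ i, b i ^ 2 ≤ L x} := by
    intro x hx
    simp only [Set.mem_setOf_eq] at hx ⊢
    rw [hLapply, hw, inner_toLp_mul]
    refine Finset.sum_le_sum fun i _ => ?_
    have := mul_le_mul_of_nonneg_left (hx i).le (hb i).le
    nlinarith
  calc P.real {x | ∀ i, b i < ε i * x i} ≤ P.real {x | ∑ i, b i ^ 2 ≤ L x} :=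
        measureReal_mono hsub (measure_ne_top _ _)
    _ ≤ Real.exp (-γ * ∑ i, b i ^ 2) * mgf (fun x => L x) P γ := hcher
    _ = Real.exp (-γ * ∑ i, b i ^ 2 + ((Var[L; P]).toNNReal : ℝ) * γ ^ 2 / 2) := by
        rw [hmgf, ← Real.exp_add]
        ring_nf
    _ ≤ Real.exp (-γ * ∑ i, b i ^ 2 + N * (∑ i, b i ^ 2) * γ ^ 2 / 2) := by
        refine Real.exp_le_exp.2 ?_
        have : ((Var[L; P]).toNNReal : ℝ) * γ ^ 2 / 2 ≤ N * (∑ i, b i ^ 2) * γ ^ 2 / 2 := by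
          have hg2 : 0 ≤ γ ^ 2 / 2 := by positivity
          nlinarith [hvar_le]
        linarith
    _ = Real.exp (-((∑ i, b i ^ 2) / (2 * N))) := by
        congr 1
        rw [hγ]
        field_simp
        ring

/-- **LEMMA 1 OF APPENDIX C of [BenfattoEtAl1978], (C.9), AS PRINTED**: for `n` centred Gaussian variables with covariance
`C ⪰ 0`, `C_ij ≥ 0` (print: «C_ij > 0»; only non-negativity is used) and thresholds `bᵢ > 0`,
`∫ Π_{i=1}^{n} χ(|z_i| > b_i) dP ≦ exp[−Σ_{i=1}^{n} (b_i²/(2‖C‖) − log 2)]`, `‖C‖ = sup_i Σ_j C_ij` — proved along print's route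
(tilt by `γ = 1/‖C‖` on each of the `2ⁿ` sign patterns, Gaussian moment generating function, union bound).
[cite: BenfattoEtAl1978, Appendix C Lemma 1 (C.9) p.165] -/
theorem appC_lemma1 (hC : C.PosSemidef) (hpos : ∀ i j, 0 ≤ C i j) (b : Fin n → ℝ) (hb : ∀ i, 0 < b i) :
    (multivariateGaussian 0 C).real {x | ∀ i, b i < |x i|} ≤
      Real.exp (-(∑ i, (b i ^ 2 / (2 * ⨆ i, ∑ j, C i j) - Real.log 2))) := by
  classical
  set P := multivariateGaussian 0 C with hP
  set N : ℝ := ⨆ i, ∑ j, C i j with hN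
  have hN0 : 0 ≤ N := Real.iSup_nonneg fun i => Finset.sum_nonneg fun j _ => hpos i j
  have hrow : ∀ i, ∑ j, C i j ≤ N := fun i => le_ciSup (f := fun i => ∑ j, C i j) (Set.finite_range _).bddAbove i
  -- the printed right side is `2ⁿ · exp(−Σb²/(2N))`
  have hrhs : Real.exp (-(∑ i, (b i ^ 2 / (2 * N) - Real.log 2))) =
      (2 : ℝ) ^ n * Real.exp (-((∑ i, b i ^ 2) / (2 * N))) := by
    have hs : ∑ i, (b i ^ 2 / (2 * N) - Real.log 2) = (∑ i, b i ^ 2) / (2 * N) - n * Real.log 2 := by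
      rw [Finset.sum_sub_distrib, Finset.sum_div, Finset.sum_const, Finset.card_univ, Fintype.card_fin, nsmul_eq_mul]
    rw [hs, neg_sub, sub_eq_add_neg, Real.exp_add, Real.exp_nat_mul, Real.exp_log two_pos]
  rw [hrhs]
  have hPle : P.real {x | ∀ i, b i < |x i|} ≤ 1 := by
    calc P.real {x | ∀ i, b i < |x i|} ≤ P.real Set.univ := measureReal_mono (Set.subset_univ _) (measure_ne_top _ _)
      _ = 1 := probReal_univ
  rcases hN0.eq_or_lt with hN00 | hNpos
  · -- degenerate: `‖C‖ = 0`, the printed bound is `2ⁿ ≥ 1`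
    rw [← hN00]
    simp only [mul_zero, div_zero, neg_zero, Real.exp_zero, mul_one]
    exact hPle.trans (one_le_pow₀ (by norm_num))
  -- the union over sign patterns
  have hcover : {x : EuclideanSpace ℝ (Fin n) | ∀ i, b i < |x i|} ⊆
      ⋃ s : Finset (Fin n), {x | ∀ i, b i < (if i ∈ s then (1 : ℝ) else -1) * x i} := by
    intro x hx
    simp only [Set.mem_setOf_eq] at hx
    refine Set.mem_iUnion.2 ⟨Finset.univ.filter fun i => 0 < x i, fun i => ?_⟩
    simp only [Finset.mem_filter, Finset.mem_univ, true_and]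
    by_cases h : 0 < x i
    · rw [if_pos h, one_mul, ← abs_of_pos h]
      exact hx i
    · rw [if_neg h, neg_one_mul, ← abs_of_nonpos (not_lt.1 h)]
      exact hx i
  have hε : ∀ (s : Finset (Fin n)) (i : Fin n), |(if i ∈ s then (1 : ℝ) else -1)| = 1 := by
    intro s i
    split_ifs <;> norm_num
  calc P.real {x | ∀ i, b i < |x i|}
      ≤ P.real (⋃ s : Finset (Fin n), {x | ∀ i, b i < (if i ∈ s then (1 : ℝ) else -1) * x i}) :=
        measureReal_mono hcover (measure_ne_top _ _)
    _ ≤ ∑ s : Finset (Fin n), P.real {x | ∀ i, b i < (if i ∈ s then (1 : ℝ) else -1) * x i} :=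
        measureReal_iUnion_fintype_le _
    _ ≤ ∑ _s : Finset (Fin n), Real.exp (-((∑ i, b i ^ 2) / (2 * N))) :=
        Finset.sum_le_sum fun s _ => measureReal_signEvent_le C hC hpos hb hNpos hrow (hε s)
    _ = (2 : ℝ) ^ n * Real.exp (-((∑ i, b i ^ 2) / (2 * N))) := by
        rw [Finset.sum_const, Finset.card_univ, Fintype.card_finset, Fintype.card_fin, nsmul_eq_mul]
        push_cast
        ring

end Lemma1

/-! ## §2  Point 2) of Appendix C: the diagonal part of (C.6) for the tree's conditioned field -/

section PointTwo

open Literature.MathematicalPhysics.QuantumFieldTheory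
open Literature.MathematicalPhysics.QuantumFieldTheory.Balaban1983to89.B1Eq324BenfattoLemma

variable {d : ℕ}

/-- **(C.6), diagonal part — conditioning lowers the variance**: for a positive semidefinite kernel `G` on `Q₀` and a
conditioning region `Γ`, the Schur-complement (regression, «Dirichelet boundary condition») covariance of the tree's
conditioned field satisfies `C^Γ_ΔΔ ≤ C_ΔΔ`, i.e. `condCov G Γ x x ≤ G x x` — the subtracted term is the quadratic form of
`(G_ΓΓ)⁻¹ ⪰ 0` at `(G(x, c))_{c∈Γ}`.  (The entrywise `0 ≤ C^Γ_{ΔΔ′} ≤ C_{ΔΔ′}` of print needs the walk representation (C.3) and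
is not proved here.) [cite: BenfattoEtAl1978, Appendix C (C.6) p.164] -/
theorem condCov_self_le {G : B1Eq324BenfattoLemma.Site d → B1Eq324BenfattoLemma.Site d → ℝ}
    (hG : IsPosSemidefKernel G) (Γ : Finset (B1Eq324BenfattoLemma.Site d)) (x : B1Eq324BenfattoLemma.Site d) :
    condCov G Γ x x ≤ G x x := by
  rw [condCov, sub_le_self_iff]
  have hsymm : ∀ c : Γ, G x c = G c x := by
    intro c
    have h := (hG ({x} ∪ Γ)).isHermitian
    have hx : x ∈ ({x} ∪ Γ : Finset _) := Finset.mem_union_left _ (Finset.mem_singleton_self x)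
    have hc : (c : B1Eq324BenfattoLemma.Site d) ∈ ({x} ∪ Γ : Finset _) := Finset.mem_union_right _ c.2
    have := congrFun (congrFun h ⟨c, hc⟩) ⟨x, hx⟩
    simpa [covGram_apply, Matrix.conjTranspose_apply] using this
  have hpsd : ((covGram G Γ)⁻¹).PosSemidef := (hG Γ).inv
  set v : Γ → ℝ := fun c => G c x with hv
  have hq : 0 ≤ v ⬝ᵥ ((covGram G Γ)⁻¹ *ᵥ v) := by
    have := hpsd.dotProduct_mulVec_nonneg v
    simpa [star_trivial] using this
  have hexp : ∑ c : Γ, ∑ c' : Γ, G x c * (covGram G Γ)⁻¹ c c' * G c' x = v ⬝ᵥ ((covGram G Γ)⁻¹ *ᵥ v) := by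
    simp only [dotProduct, Matrix.mulVec, hv, Finset.mul_sum]
    refine Finset.sum_congr rfl fun c _ => Finset.sum_congr rfl fun c' _ => ?_
    rw [hsymm c]
    ring
  rw [hexp]
  exact hq

end PointTwo

end Literature.MathematicalPhysics.QuantumFieldTheory.Balaban1983to89.B1Eq324BenfattoAppendixC

end
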